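import Mathlib

/-!
# Wrap-cycle and shared-portal certificates for two-blocking
(crux `FoolingMeasure`, stmt-PneNP-19727; round-2 ideation seat 1, gen 26; memo `IDEATION-CENSUS-r2s1g26.md`)

Restricted-model rung (AEA cut rectangles vs NON-3-COL); nothing here bears on P vs NP.

Minimal mirror of the frame-closure definitions of `FrameTwoColourings.lean` (namespace `IdeasR2g6`,
not a built module, so `Rulers / succ / FrameClosed / TwoBlocked` are repeated verbatim).

Kernel-checked here (0 sorry):

* `arc_propagates` — a *clause arc* `v → w` of a ruler system in frame `k` (own non-wrap step upward,
  foreign step from the `k`-higher to the `k`-lower endpoint) propagates `true` through every closed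
  Boolean phase `x`.
* `frame_blocked_of_reach` / `twoBlocked_of_reach` — REACHABILITY CERTIFICATE: if in the hybrid digraph
  (Alice's arcs = steps of `P` meeting `Bᶜ`, Bob's arcs = steps of `P'` inside `B`) Alice's ruler-`k` last
  vertex `λ` and first vertex `φ = succ P k λ` reach each other, and her `k`-wrap meets `Bᶜ`, then frame `k`
  has no jointly closed phase; over all frames this is `TwoBlocked P P' B`.
* `reach_of_portals` (abstract counting lemma) and `frame_reach_of_portals` / `frame_blocked_of_portals` /
  `twoBlocked_of_portals` — SHARED PORTAL SETS (memo note g26-4, the main result of the session): fix per frame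
  two vertex sets `Ein, Eout ⊆ B`.  ROW condition on Alice's system `P` alone: the proper entries of the
  `B`-runs of her ruler `k` lie in `Ein`, `Eout` consists of proper exits of hers, her wrap `{λ, φ}` avoids `B`,
  and `φ` is reachable from `λ` by HER arcs alone (row-only descent).  COLUMN condition on Bob's system `P'` alone: `Ein`
  consists of proper entries of HIS ruler `k`, his proper exits lie in `Eout`, his wrap vertex is not in `B`.
  Then frame `k` is blocked for the pair — for EVERY pair of such a row and such a column, with no pairing of
  entries to exits and no run interior pinned (the proof is a counting argument: if `λ` were unreachable from
  `φ`, Alice's climb map would inject the reachable exits into the reachable entries missing the first entry,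
  while Bob's run map injects the reachable entries into the reachable exits).  On the diagonal the two
  conditions say "proper entries `= Ein`, proper exits `= Eout`", so a pigeonhole class of ANY measure on
  ruler systems (portal sets, `B`-residues, wrap pattern: `≈ (1 + ½·log₂3)(1+2ε)·t·n + O(t log n)` bits)
  is pairwise aligned and pairwise `TwoBlocked`.  Consequences drawn in the memo (labelled there):
  `WeakFibreExtremality t θ ε` (FrameTwoColourings) fails for every `θ < t/4 − o(1)` (H: abundance count);
  the "no planted counterexamples" argument of `Ideas/orientation-rigidity.md` §(A) does not cover
  member-dependent `Θ(n)`-arc certificates through shared portal SETS; darkness of such rectangles reduces to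
  the vortex-freeness residual `R_v` of `Ideas/k-split-product-rectangle.md`, nothing else.
* `reach_of_pins` / `twoBlocked_of_pins` — the PINNED form (four Alice arcs `φ → v`, `u → λ`, `λ → z`, `y → φ`
  and two Bob chains `v ⇝ u`, `z ⇝ y` inside `B`).  Correct but NOT a cheap rectangle: a member's own Bob
  arcs never ascend its own ruler except by its own `+1` steps (diagonal obstruction, memo note g26-3c), so
  pinned chains have member-mass 0; the portal form above is the repair (run interiors free).
* `climb` / `climb_between` / `frame_blocked_of_alternating` — ALICE-COMPLETE FRAMES: if `B` has no two
  `k`-consecutive vertices of Alice's ruler and two of her arcs `λ → z`, `y → φ` have `z` `k`-below `y`,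
  frame `k` is blocked against EVERY Bob half (row-only certificate, ≈ `n` bits per frame; note g26-3b) —
  the special case `Ein = Eout = ∅` of the portal certificate.
* `reaches_top` / `frame_blocked_of_rankings` / `ranked_of_promises` — the RANKING form of the certificate
  (every non-top vertex has an `h`-upward hybrid arc), and its RIGIDITY `ranking_rigid`: a ranking toward
  `λ` that serves every vertex of ONE system is strictly increasing along ruler `k`, i.e. it is Alice's
  height order — rankings-from-everywhere cost `log₂ (n-1)!` bits per frame and are not a cheap junta
  (note g26-3a).
-/

set_option linter.dupNamespace false

namespace Summit.PneNP.PneNP.Cruxes.FoolingMeasure.IdeasR2s1g26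

open Finset

/-- `t` rulers on `n = 3q+1` vertices: `P k v` is the position of vertex `v` along ruler `k`. -/
abbrev Rulers (q t : ℕ) := Fin t → Equiv.Perm (Fin (3 * q + 1))

variable {q t : ℕ}

/-- successor of `v` along ruler `k`. -/
def succ (P : Rulers q t) (k : Fin t) (v : Fin (3 * q + 1)) : Fin (3 * q + 1) :=
  (P k).symm (P k v + 1)

/-- (verbatim from `IdeasR2g6`) `x : V → Bool` is CLOSED for the steps of `R` selected by `sel` in frame `k`. -/
def FrameClosed (R : Rulers q t) (k : Fin t) (sel : Fin (3 * q + 1) → Fin (3 * q + 1) → Prop)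
    (x : Fin (3 * q + 1) → Bool) : Prop :=
  ∀ j u, sel u (succ R j u) →
    (j = k → (R k u).val ≠ 3 * q → x u = true → x (succ R j u) = true) ∧
    (j = k → (R k u).val = 3 * q → x u ≠ x (succ R j u)) ∧
    (j ≠ k → (R k u).val < (R k (succ R j u)).val → x (succ R j u) = true → x u = true) ∧
    (j ≠ k → (R k (succ R j u)).val < (R k u).val → x u = true → x (succ R j u) = true)

/-- (verbatim from `IdeasR2g6`) no frame admits a jointly (Alice-in-`P`, Bob-in-`P'`) closed `x`. -/
def TwoBlocked (P P' : Rulers q t) (B : Finset (Fin (3 * q + 1))) : Prop :=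
  ∀ (k : Fin t) (x : Fin (3 * q + 1) → Bool),
    ¬ (FrameClosed P k (fun u w => u ∉ B ∨ w ∉ B) x ∧ FrameClosed P' k (fun u w => u ∈ B ∧ w ∈ B) x)

/-! ## Clause arcs -/

/-- CLAUSE ARC `v → w` of system `R` in frame `k` among the `sel`-selected steps: the own non-wrap
`k`-step out of `v`, or a foreign step `{v, w}` whose `k`-higher endpoint (in `R`) is `v`. -/
def Arc (R : Rulers q t) (k : Fin t) (sel : Fin (3 * q + 1) → Fin (3 * q + 1) → Prop)
    (v w : Fin (3 * q + 1)) : Prop :=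
  ∃ j u, sel u (succ R j u) ∧
    ((j = k ∧ u = v ∧ succ R j u = w ∧ (R k u).val ≠ 3 * q) ∨
     (j ≠ k ∧ succ R j u = v ∧ u = w ∧ (R k u).val < (R k (succ R j u)).val) ∨
     (j ≠ k ∧ u = v ∧ succ R j u = w ∧ (R k (succ R j u)).val < (R k u).val))

/-- a closed `x` propagates `true` along every clause arc. -/
theorem arc_propagates (R : Rulers q t) (k : Fin t) (sel : Fin (3 * q + 1) → Fin (3 * q + 1) → Prop)
    (x : Fin (3 * q + 1) → Bool) (hx : FrameClosed R k sel x) {v w : Fin (3 * q + 1)}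
    (harc : Arc R k sel v w) (hv : x v = true) : x w = true := by
  obtain ⟨j, u, hsel, hcase⟩ := harc
  obtain ⟨c1, _, c3, c4⟩ := hx j u hsel
  rcases hcase with ⟨hjk, huv, hw, hne⟩ | ⟨hjk, hvu, huw, hlt⟩ | ⟨hjk, huv, hw, hlt⟩
  · subst huv; subst hw; exact c1 hjk hne hv
  · subst hvu; subst huw; exact c3 hjk hlt hv
  · subst huv; subst hw; exact c4 hjk hlt hv

/-! ## The ranking certificate -/

/-- FINITE-MAXIMUM LEMMA: if every vertex other than `top` has an `Arc` to a strictly higher-ranked vertex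
and `x` propagates along arcs, then `x v = true` forces `x top = true`. -/
theorem reaches_top {V : Type*} [Fintype V] [DecidableEq V] (A : V → V → Prop) (h : V → ℕ) (top : V)
    (x : V → Bool) (hup : ∀ v, v ≠ top → ∃ w, A v w ∧ h v < h w)
    (hprop : ∀ v w, A v w → x v = true → x w = true) (v : V) (hv : x v = true) : x top = true := by
  by_contra htop
  obtain ⟨u, huT, humax⟩ :=
    Finset.exists_max_image (Finset.univ.filter fun u => x u = true) h ⟨v, by simp [hv]⟩
  have hxu : x u = true := by simpa using huT
  have hune : u ≠ top := by
    rintro rfl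
    exact htop hxu
  obtain ⟨w, harc, hlt⟩ := hup u hune
  have hxw : x w = true := hprop u w harc hxu
  have hle := humax w (by simp [hxw])
  omega

/-- the union of Alice's (system `P`, steps meeting `Bᶜ`) and Bob's (system `P'`, steps inside `B`)
clause arcs in frame `k`. -/
def HybridArc (P P' : Rulers q t) (B : Finset (Fin (3 * q + 1))) (k : Fin t)
    (v w : Fin (3 * q + 1)) : Prop :=
  Arc P k (fun u w => u ∉ B ∨ w ∉ B) v w ∨ Arc P' k (fun u w => u ∈ B ∧ w ∈ B) v w

/-- a RANKING toward `top`: every other vertex has a hybrid clause arc to a strictly higher vertex. -/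
def Ranked (P P' : Rulers q t) (B : Finset (Fin (3 * q + 1))) (k : Fin t) (h : Fin (3 * q + 1) → ℕ)
    (top : Fin (3 * q + 1)) : Prop :=
  ∀ v, v ≠ top → ∃ w, HybridArc P P' B k v w ∧ h v < h w

/-- RANKING CERTIFICATE FOR ONE FRAME.  If `lam` is Alice's ruler-`k` last vertex, her `k`-wrap
`{lam, succ P k lam}` meets the complement of `B`, one ranking is topped by `lam` and another by
`succ P k lam`, then frame `k` has no jointly closed Boolean phase. -/
theorem frame_blocked_of_rankings (P P' : Rulers q t) (B : Finset (Fin (3 * q + 1))) (k : Fin t)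
    (lam : Fin (3 * q + 1)) (hlast : (P k lam).val = 3 * q)
    (hwrap : lam ∉ B ∨ succ P k lam ∉ B)
    (h₁ h₂ : Fin (3 * q + 1) → ℕ) (hr₁ : Ranked P P' B k h₁ lam) (hr₂ : Ranked P P' B k h₂ (succ P k lam))
    (x : Fin (3 * q + 1) → Bool) :
    ¬ (FrameClosed P k (fun u w => u ∉ B ∨ w ∉ B) x ∧ FrameClosed P' k (fun u w => u ∈ B ∧ w ∈ B) x) := by
  rintro ⟨hA, hB⟩
  have hprop : ∀ v w, HybridArc P P' B k v w → x v = true → x w = true := by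
    intro v w harc hv
    rcases harc with harc | harc
    · exact arc_propagates P k _ x hA harc hv
    · exact arc_propagates P' k _ x hB harc hv
  -- Alice's wrap clause: the phase flips across `{lam, succ P k lam}`
  have hflip : x lam ≠ x (succ P k lam) := (hA k lam hwrap).2.1 rfl hlast
  cases hl : x lam
  · -- x lam = false, so x (succ lam) = true, which climbs `h₁` back to lam
    have hs : x (succ P k lam) = true := by
      cases hs' : x (succ P k lam)
      · exact absurd (hl.trans hs'.symm) hflip
      · rfl
    have := reaches_top (HybridArc P P' B k) h₁ lam x hr₁ hprop _ hs
    rw [hl] at this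
    exact Bool.false_ne_true this
  · -- x lam = true climbs `h₂` to succ lam, contradicting the flip
    have := reaches_top (HybridArc P P' B k) h₂ (succ P k lam) x hr₂ hprop _ hl
    exact hflip (hl.trans this.symm)

/-- RANKING CERTIFICATE (all frames): `2t` rankings and pinned Alice wraps meeting `Bᶜ` force `TwoBlocked`. -/
theorem twoBlocked_of_rankings (P P' : Rulers q t) (B : Finset (Fin (3 * q + 1)))
    (lam : Fin t → Fin (3 * q + 1)) (hlast : ∀ k, (P k (lam k)).val = 3 * q)
    (hwrap : ∀ k, lam k ∉ B ∨ succ P k (lam k) ∉ B)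
    (h₁ h₂ : Fin t → Fin (3 * q + 1) → ℕ)
    (hr₁ : ∀ k, Ranked P P' B k (h₁ k) (lam k)) (hr₂ : ∀ k, Ranked P P' B k (h₂ k) (succ P k (lam k))) :
    TwoBlocked P P' B := fun k x =>
  frame_blocked_of_rankings P P' B k (lam k) (hlast k) (hwrap k) (h₁ k) (h₂ k) (hr₁ k) (hr₂ k) x

/-! ## Product form of the hypothesis

For a FIXED designation `DA` (who certifies which vertex), `Ranked` follows from a row condition on
Alice's half and a column condition on Bob's half separately — this is what makes the certified
rectangle a product of one-sided classes. -/

/-- Alice's promise: every designated vertex other than `top` has an `h`-upward ALICE clause arc. -/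
def RowPromise (P : Rulers q t) (B DA : Finset (Fin (3 * q + 1))) (k : Fin t)
    (h : Fin (3 * q + 1) → ℕ) (top : Fin (3 * q + 1)) : Prop :=
  ∀ v ∈ DA, v ≠ top → ∃ w, Arc P k (fun u w => u ∉ B ∨ w ∉ B) v w ∧ h v < h w

/-- Bob's promise: every undesignated vertex other than `top` has an `h`-upward BOB clause arc. -/
def ColPromise (P' : Rulers q t) (B DA : Finset (Fin (3 * q + 1))) (k : Fin t)
    (h : Fin (3 * q + 1) → ℕ) (top : Fin (3 * q + 1)) : Prop :=
  ∀ v ∉ DA, v ≠ top → ∃ w, Arc P' k (fun u w => u ∈ B ∧ w ∈ B) v w ∧ h v < h w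

theorem ranked_of_promises (P P' : Rulers q t) (B DA : Finset (Fin (3 * q + 1))) (k : Fin t)
    (h : Fin (3 * q + 1) → ℕ) (top : Fin (3 * q + 1))
    (hrow : RowPromise P B DA k h top) (hcol : ColPromise P' B DA k h top) :
    Ranked P P' B k h top := by
  intro v hv
  by_cases hD : v ∈ DA
  · obtain ⟨w, ha, hlt⟩ := hrow v hD hv
    exact ⟨w, Or.inl ha, hlt⟩
  · obtain ⟨w, hb, hlt⟩ := hcol v hD hv
    exact ⟨w, Or.inr hb, hlt⟩


/-! ## Reachability certificate (pinned wrap cycles) -/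

/-- a jointly closed phase propagates `true` along hybrid paths. -/
theorem closed_reach (P P' : Rulers q t) (B : Finset (Fin (3 * q + 1))) (k : Fin t)
    (x : Fin (3 * q + 1) → Bool)
    (hA : FrameClosed P k (fun u w => u ∉ B ∨ w ∉ B) x) (hB : FrameClosed P' k (fun u w => u ∈ B ∧ w ∈ B) x)
    {v w : Fin (3 * q + 1)} (hr : Relation.ReflTransGen (HybridArc P P' B k) v w) (hv : x v = true) :
    x w = true := by
  induction hr with
  | refl => exact hv
  | tail _ harc ih =>
    rcases harc with harc | harc
    · exact arc_propagates P k _ x hA harc ih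
    · exact arc_propagates P' k _ x hB harc ih

/-- REACHABILITY CERTIFICATE FOR ONE FRAME: `λ ⇝ φ` and `φ ⇝ λ` in the hybrid digraph (with Alice's
`k`-wrap `{λ, φ}` meeting `Bᶜ`) leave no jointly closed phase. -/
theorem frame_blocked_of_reach (P P' : Rulers q t) (B : Finset (Fin (3 * q + 1))) (k : Fin t)
    (lam : Fin (3 * q + 1)) (hlast : (P k lam).val = 3 * q) (hwrap : lam ∉ B ∨ succ P k lam ∉ B)
    (h₁ : Relation.ReflTransGen (HybridArc P P' B k) (succ P k lam) lam)
    (h₂ : Relation.ReflTransGen (HybridArc P P' B k) lam (succ P k lam))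
    (x : Fin (3 * q + 1) → Bool) :
    ¬ (FrameClosed P k (fun u w => u ∉ B ∨ w ∉ B) x ∧ FrameClosed P' k (fun u w => u ∈ B ∧ w ∈ B) x) := by
  rintro ⟨hA, hB⟩
  have hflip : x lam ≠ x (succ P k lam) := (hA k lam hwrap).2.1 rfl hlast
  cases hl : x lam
  · have hs : x (succ P k lam) = true := by
      cases hs' : x (succ P k lam)
      · exact absurd (hl.trans hs'.symm) hflip
      · rfl
    have := closed_reach P P' B k x hA hB h₁ hs
    rw [hl] at this
    exact Bool.false_ne_true this
  · exact hflip (hl.trans (closed_reach P P' B k x hA hB h₂ hl).symm)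

/-- REACHABILITY CERTIFICATE (all frames). -/
theorem twoBlocked_of_reach (P P' : Rulers q t) (B : Finset (Fin (3 * q + 1)))
    (lam : Fin t → Fin (3 * q + 1)) (hlast : ∀ k, (P k (lam k)).val = 3 * q)
    (hwrap : ∀ k, lam k ∉ B ∨ succ P k (lam k) ∉ B)
    (h₁ : ∀ k, Relation.ReflTransGen (HybridArc P P' B k) (succ P k (lam k)) (lam k))
    (h₂ : ∀ k, Relation.ReflTransGen (HybridArc P P' B k) (lam k) (succ P k (lam k))) :
    TwoBlocked P P' B := fun k x =>
  frame_blocked_of_reach P P' B k (lam k) (hlast k) (hwrap k) (h₁ k) (h₂ k) x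

/-! ## Product form: four Alice arcs and two Bob chains

`AlicePins` is a condition on Alice's half alone (her selected steps at the pinned vertices), `BobChains`
on Bob's half alone (paths of his selected steps inside `B`); together they give the two reachabilities,
hence (with the wrap hypotheses) a blocked frame — for EVERY pair of a rectangle whose rows satisfy the
pins and whose columns satisfy the chains. -/

/-- Alice's pins in frame `k`: arcs `φ → v`, `u → λ`, `λ → z`, `y → φ` among her steps meeting `Bᶜ`. -/
def AlicePins (P : Rulers q t) (B : Finset (Fin (3 * q + 1))) (k : Fin t)
    (lam phi v u z y : Fin (3 * q + 1)) : Prop :=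
  Arc P k (fun a b => a ∉ B ∨ b ∉ B) phi v ∧ Arc P k (fun a b => a ∉ B ∨ b ∉ B) u lam ∧
  Arc P k (fun a b => a ∉ B ∨ b ∉ B) lam z ∧ Arc P k (fun a b => a ∉ B ∨ b ∉ B) y phi

/-- Bob's chains in frame `k`: `v ⇝ u` and `z ⇝ y` along his steps inside `B`. -/
def BobChains (P' : Rulers q t) (B : Finset (Fin (3 * q + 1))) (k : Fin t)
    (v u z y : Fin (3 * q + 1)) : Prop :=
  Relation.ReflTransGen (Arc P' k (fun a b => a ∈ B ∧ b ∈ B)) v u ∧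
  Relation.ReflTransGen (Arc P' k (fun a b => a ∈ B ∧ b ∈ B)) z y

theorem reach_of_pins (P P' : Rulers q t) (B : Finset (Fin (3 * q + 1))) (k : Fin t)
    (lam phi v u z y : Fin (3 * q + 1))
    (ha : AlicePins P B k lam phi v u z y) (hb : BobChains P' B k v u z y) :
    Relation.ReflTransGen (HybridArc P P' B k) phi lam ∧
    Relation.ReflTransGen (HybridArc P P' B k) lam phi := by
  obtain ⟨h1, h2, h3, h4⟩ := ha
  obtain ⟨c1, c2⟩ := hb
  have lift : ∀ {a b}, Relation.ReflTransGen (Arc P' k (fun a b => a ∈ B ∧ b ∈ B)) a b →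
      Relation.ReflTransGen (HybridArc P P' B k) a b :=
    by
      intro a b h
      induction h with
      | refl => exact Relation.ReflTransGen.refl
      | tail _ hbc ih => exact ih.tail (Or.inr hbc)
  have one : ∀ {a b}, Arc P k (fun a b => a ∉ B ∨ b ∉ B) a b →
      Relation.ReflTransGen (HybridArc P P' B k) a b :=
    fun h => Relation.ReflTransGen.single (Or.inl h)
  constructor
  · -- φ → v ⇝ u → λ
    exact ((one h1).trans (lift c1)).trans (one h2)
  · -- λ → z ⇝ y → φ
    exact ((one h3).trans (lift c2)).trans (one h4)

/-- PINNED WRAP CYCLES force `TwoBlocked`: per frame, Alice's pinned wrap `(λ_k, φ_k = succ P k λ_k)`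
meeting `Bᶜ`, her four pinned arcs, and Bob's two chains. -/
theorem twoBlocked_of_pins (P P' : Rulers q t) (B : Finset (Fin (3 * q + 1)))
    (lam v u z y : Fin t → Fin (3 * q + 1)) (hlast : ∀ k, (P k (lam k)).val = 3 * q)
    (hwrap : ∀ k, lam k ∉ B ∨ succ P k (lam k) ∉ B)
    (ha : ∀ k, AlicePins P B k (lam k) (succ P k (lam k)) (v k) (u k) (z k) (y k))
    (hb : ∀ k, BobChains P' B k (v k) (u k) (z k) (y k)) : TwoBlocked P P' B :=
  twoBlocked_of_reach P P' B lam hlast hwrap (fun k => (reach_of_pins P P' B k _ _ _ _ _ _ (ha k) (hb k)).1)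
    (fun k => (reach_of_pins P P' B k _ _ _ _ _ _ (ha k) (hb k)).2)

/-! ## Rigidity of rankings-from-everywhere

A ranking toward Alice's LAST vertex `λ` that gives every other vertex an upward clause arc of ONE system
(any selection of its steps) is strictly increasing along ruler `k`: every height-prefix
`{w : P k w ≤ i}` is closed under clause arcs except for the own step leaving its top vertex, so its
`h`-maximum must be that vertex.  Hence such a ranking IS the height order, and a member of a
ranking junta has its whole ruler `k` fixed by the data (`log₂ (n-1)!` bits): rankings-from-everywhere
are not a cheap certificate, pinned cycles are. -/

theorem val_succ (P : Rulers q t) (k : Fin t) (m : Fin (3 * q + 1)) (hne : (P k m).val ≠ 3 * q) :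
    (P k (succ P k m)).val = (P k m).val + 1 := by
  have hlt : P k m < Fin.last (3 * q) := by
    rw [Fin.lt_def, Fin.val_last]
    exact lt_of_le_of_ne (Nat.lt_succ_iff.mp (P k m).isLt) hne
  simp only [succ, Equiv.apply_symm_apply]
  exact Fin.val_add_one_of_lt hlt

theorem ranking_rigid (P : Rulers q t) (k : Fin t) (sel : Fin (3 * q + 1) → Fin (3 * q + 1) → Prop)
    (h : Fin (3 * q + 1) → ℕ) (lam : Fin (3 * q + 1)) (hlast : (P k lam).val = 3 * q)
    (hup : ∀ v, v ≠ lam → ∃ w, Arc P k sel v w ∧ h v < h w)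
    (u : Fin (3 * q + 1)) (hu : (P k u).val ≠ 3 * q) : h u < h (succ P k u) := by
  classical
  -- the height prefix through `u`
  set U : Finset (Fin (3 * q + 1)) := Finset.univ.filter fun w => (P k w).val ≤ (P k u).val with hU
  obtain ⟨m, hmU, hmax⟩ := Finset.exists_max_image U h ⟨u, by simp [hU]⟩
  have hmle : (P k m).val ≤ (P k u).val := by simpa [hU] using hmU
  have hu_lt : (P k u).val < 3 * q := lt_of_le_of_ne (Nat.lt_succ_iff.mp (P k u).isLt) hu
  have hm_ne : m ≠ lam := by
    rintro rfl
    omega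
  obtain ⟨w, harc, hlt⟩ := hup m hm_ne
  -- `w` cannot lie in the prefix (maximality of `m`), so the arc is the own step out of the top vertex `u`
  have hw_out : ¬ (P k w).val ≤ (P k u).val := by
    intro hw
    have hwU : w ∈ U := by
      rw [hU, Finset.mem_filter]; exact ⟨Finset.mem_univ _, hw⟩
    have := hmax w hwU
    omega
  obtain ⟨j, a, _, hcase⟩ := harc
  rcases hcase with ⟨hjk, hav, hw, hne⟩ | ⟨_, hva, haw, hlt'⟩ | ⟨_, hav, hw, hlt'⟩
  · -- own step: `w = succ P k m`, height `+1`; outside the prefix forces `P k m = P k u`, i.e. `m = u`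
    rw [hav] at hne hw
    rw [hjk] at hw
    have hval := val_succ P k m hne
    rw [hw] at hval
    have hmu : (P k m).val = (P k u).val := by omega
    have hm : m = u := (P k).injective (Fin.ext hmu)
    rw [hm] at hw hlt
    rw [hw]; exact hlt
  · -- foreign step read downward: `w = a` is `k`-lower than `m = succ P j a`, so inside the prefix
    rw [hva, haw] at hlt'
    exact (hw_out (le_trans hlt'.le hmle)).elim
  · rw [hw, hav] at hlt'
    exact (hw_out (le_trans hlt'.le hmle)).elim

/-! ## Alice-complete frames: a ROW-ONLY certificate

If `B` contains no two `k`-consecutive vertices of Alice's ruler (every own `k`-step meets `Bᶜ`), Alice alone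
climbs the whole ruler, so `φ ⇝ λ`; if moreover some arc `λ → z` and some arc `y → φ` of hers have `z`
`k`-below `y`, then `λ → z ⇝ y → φ`.  Frame `k` is then blocked against EVERY Bob half — no column clause.
(Memo §2, note g26-3b: cost ≈ `n` bits per frame; half-density of the species allows at most `t - 2` such frames.) -/

theorem climb (P : Rulers q t) (B : Finset (Fin (3 * q + 1))) (k : Fin t)
    (halt : ∀ u, (P k u).val ≠ 3 * q → (u ∉ B ∨ succ P k u ∉ B)) :
    ∀ d : ℕ, ∀ v w : Fin (3 * q + 1), (P k w).val = (P k v).val + d →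
      Relation.ReflTransGen (Arc P k (fun a b => a ∉ B ∨ b ∉ B)) v w := by
  intro d
  induction d with
  | zero =>
    intro v w h
    have : w = v := (P k).injective (Fin.ext (by simpa using h))
    subst this
    exact Relation.ReflTransGen.refl
  | succ d ih =>
    intro v w h
    have hne : (P k v).val ≠ 3 * q := by
      have := (P k w).isLt
      omega
    have hstep : Arc P k (fun a b => a ∉ B ∨ b ∉ B) v (succ P k v) :=
      ⟨k, v, halt v hne, Or.inl ⟨rfl, rfl, rfl, hne⟩⟩
    have hval := val_succ P k v hne
    exact Relation.ReflTransGen.head hstep (ih (succ P k v) w (by omega))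

/-- ALICE-COMPLETE FRAME: row-only blocking certificate. -/
theorem frame_blocked_of_alternating (P P' : Rulers q t) (B : Finset (Fin (3 * q + 1))) (k : Fin t)
    (lam : Fin (3 * q + 1)) (hlast : (P k lam).val = 3 * q) (hlamA : lam ∉ B)
    (halt : ∀ u, (P k u).val ≠ 3 * q → (u ∉ B ∨ succ P k u ∉ B))
    (z y : Fin (3 * q + 1)) (hz : Arc P k (fun a b => a ∉ B ∨ b ∉ B) lam z)
    (hy : Arc P k (fun a b => a ∉ B ∨ b ∉ B) y (succ P k lam)) (hzy : (P k z).val ≤ (P k y).val)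
    (x : Fin (3 * q + 1) → Bool) :
    ¬ (FrameClosed P k (fun u w => u ∉ B ∨ w ∉ B) x ∧ FrameClosed P' k (fun u w => u ∈ B ∧ w ∈ B) x) := by
  have lift : ∀ {a b}, Relation.ReflTransGen (Arc P k (fun a b => a ∉ B ∨ b ∉ B)) a b →
      Relation.ReflTransGen (HybridArc P P' B k) a b := by
    intro a b h
    induction h with
    | refl => exact Relation.ReflTransGen.refl
    | tail _ hbc ih => exact ih.tail (Or.inl hbc)
  refine frame_blocked_of_reach P P' B k lam hlast (Or.inl hlamA) ?_ ?_ x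
  · -- φ ⇝ λ : climb the whole ruler
    have hle : (P k (succ P k lam)).val ≤ (P k lam).val := by
      have := (P k (succ P k lam)).isLt
      omega
    exact lift (climb P B k halt ((P k lam).val - (P k (succ P k lam)).val) _ _ (by omega))
  · -- λ → z ⇝ y → φ
    have hzy' := lift (climb P B k halt ((P k y).val - (P k z).val) z y (by omega))
    have hz' : Relation.ReflTransGen (HybridArc P P' B k) lam z :=
      Relation.ReflTransGen.single (Or.inl hz)
    exact (hz'.trans hzy').tail (Or.inl hy)

/-! ## Shared portals: the counting certificate

Abstract form.  `R` is any arc relation (the hybrid digraph of a frame); `Ein`/`Eout` are the shared PORTAL SETS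
(entries / exits of the proper `B`-runs, common to all members of the rectangle); `π` is Bob's run map (column
side: every entry is carried to an exit, injectively) and `ν` is Alice's climb map (row side: every exit is carried
to the next entry above it or to `λ`, injectively, never hitting the first entry `e₁`).  Then `φ ⇝ λ`: otherwise the
reachable entries would outnumber the reachable exits by one (via `ν` and `e₁`) and at the same time inject into
them (via `π`).  No pairing between entries and exits is pinned — this is why all-pairs two-blocking costs only the
portal SETS (≈ `2·log₂ C(|B|, r) ≤ n` bits per frame), memo §2 note g26-4. -/

theorem reach_of_portals {V : Type*} [DecidableEq V] (R : V → V → Prop) (phi lam e₁ : V)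
    (Ein Eout : Finset V) (π ν : V → V)
    (hπ : ∀ e ∈ Ein, π e ∈ Eout ∧ Relation.ReflTransGen R e (π e)) (hπinj : Set.InjOn π Ein)
    (hν : ∀ x ∈ Eout, (ν x ∈ Ein ∨ ν x = lam) ∧ Relation.ReflTransGen R x (ν x))
    (hνinj : Set.InjOn ν Eout)
    (he₁ : Relation.ReflTransGen R phi e₁) (he₁' : e₁ = lam ∨ (e₁ ∈ Ein ∧ ∀ x ∈ Eout, ν x ≠ e₁)) :
    Relation.ReflTransGen R phi lam := by
  classical
  by_contra hcon
  -- reachable portals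
  set I := Ein.filter (fun v => Relation.ReflTransGen R phi v) with hI
  set X := Eout.filter (fun v => Relation.ReflTransGen R phi v) with hX
  -- e₁ is a reachable entry
  have he₁I : e₁ ∈ I := by
    rcases he₁' with h | ⟨h, -⟩
    · exact absurd (h ▸ he₁) hcon
    · exact Finset.mem_filter.2 ⟨h, he₁⟩
  have he₁ν : ∀ x ∈ Eout, ν x ≠ e₁ := by
    rcases he₁' with h | ⟨-, h⟩
    · exact absurd (h ▸ he₁) hcon
    · exact h
  -- ν maps reachable exits injectively into reachable entries other than e₁
  have hνmap : ∀ x ∈ X, ν x ∈ I.erase e₁ := by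
    intro x hx
    obtain ⟨hxE, hxr⟩ := Finset.mem_filter.1 hx
    obtain ⟨hνx, hreach⟩ := hν x hxE
    have hr : Relation.ReflTransGen R phi (ν x) := hxr.trans hreach
    rcases hνx with hin | hlam
    · exact Finset.mem_erase.2 ⟨he₁ν x hxE, Finset.mem_filter.2 ⟨hin, hr⟩⟩
    · exact absurd (hlam ▸ hr) hcon
  have hcard₁ : X.card ≤ (I.erase e₁).card :=
    Finset.card_le_card_of_injOn ν hνmap (fun a ha b hb hab =>
      hνinj (Finset.mem_filter.1 (Finset.mem_coe.1 ha)).1 (Finset.mem_filter.1 (Finset.mem_coe.1 hb)).1 hab)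
  -- π maps reachable entries injectively into reachable exits
  have hπmap : ∀ e ∈ I, π e ∈ X := by
    intro e he
    obtain ⟨heE, her⟩ := Finset.mem_filter.1 he
    obtain ⟨hπe, hreach⟩ := hπ e heE
    exact Finset.mem_filter.2 ⟨hπe, her.trans hreach⟩
  have hcard₂ : I.card ≤ X.card :=
    Finset.card_le_card_of_injOn π hπmap (fun a ha b hb hab =>
      hπinj (Finset.mem_filter.1 (Finset.mem_coe.1 ha)).1 (Finset.mem_filter.1 (Finset.mem_coe.1 hb)).1 hab)
  have hcard₃ : (I.erase e₁).card + 1 = I.card := Finset.card_erase_add_one he₁I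
  omega

/-! ### Instantiation: portal sets of ruler systems

Row side (Alice, system `P`): every PROPER ENTRY of a `B`-run of her ruler `k` (a `B`-vertex entered from `Bᶜ`
and continuing inside `B`) lies in `Ein`, every element of `Eout` is a PROPER EXIT of hers, and her wrap
`{λ, φ}` lies in `Bᶜ`.  Column side (Bob, system `P'`): every element of `Ein` is a proper entry of HIS ruler `k`,
every proper exit of his lies in `Eout`, and his wrap is not inside `B`.  (On the diagonal `P = P'` the four
inclusions say: proper entries `= Ein`, proper exits `= Eout`.)  Then `φ ⇝ λ` in the hybrid digraph of frame `k`. -/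

/-- predecessor of `v` along ruler `k`. -/
def pred (P : Rulers q t) (k : Fin t) (v : Fin (3 * q + 1)) : Fin (3 * q + 1) :=
  (P k).symm (P k v - 1)

theorem succ_pred (P : Rulers q t) (k : Fin t) (v : Fin (3 * q + 1)) : succ P k (pred P k v) = v := by
  simp [succ, pred]

theorem pred_succ (P : Rulers q t) (k : Fin t) (v : Fin (3 * q + 1)) : pred P k (succ P k v) = v := by
  simp [succ, pred]

theorem val_pred (P : Rulers q t) (k : Fin t) (v : Fin (3 * q + 1)) (hne : (P k v).val ≠ 0) :
    (P k (pred P k v)).val = (P k v).val - 1 := by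
  have h0 : P k v ≠ 0 := fun h => hne (by rw [h]; rfl)
  simp only [pred, Equiv.apply_symm_apply, Fin.coe_sub_one, h0, if_false]

theorem val_phi (P : Rulers q t) (k : Fin t) (lam : Fin (3 * q + 1)) (hlast : (P k lam).val = 3 * q) :
    (P k (succ P k lam)).val = 0 := by
  have hl : P k lam = Fin.last (3 * q) := Fin.ext (by simpa using hlast)
  simp only [succ, Equiv.apply_symm_apply, hl, Fin.last_add_one, Fin.val_zero]

/-- Alice climbs from `v` to `w` when no vertex of `[v, w)` is stuck (in `B` with successor in `B`). -/
theorem climb_between (P : Rulers q t) (B : Finset (Fin (3 * q + 1))) (k : Fin t) :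
    ∀ d : ℕ, ∀ v w : Fin (3 * q + 1), (P k w).val = (P k v).val + d →
      (∀ u, (P k v).val ≤ (P k u).val → (P k u).val < (P k w).val → (u ∉ B ∨ succ P k u ∉ B)) →
      Relation.ReflTransGen (Arc P k (fun a b => a ∉ B ∨ b ∉ B)) v w := by
  intro d
  induction d with
  | zero =>
    intro v w h _
    have : w = v := (P k).injective (Fin.ext (by simpa using h))
    subst this
    exact Relation.ReflTransGen.refl
  | succ d ih =>
    intro v w h hfree
    have hne : (P k v).val ≠ 3 * q := by
      have := (P k w).isLt
      omega
    have hsel := hfree v le_rfl (by omega)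
    have hstep : Arc P k (fun a b => a ∉ B ∨ b ∉ B) v (succ P k v) :=
      ⟨k, v, hsel, Or.inl ⟨rfl, rfl, rfl, hne⟩⟩
    have hval := val_succ P k v hne
    refine Relation.ReflTransGen.head hstep (ih (succ P k v) w (by omega) ?_)
    intro u hu1 hu2
    exact hfree u (by omega) hu2

/-- Bob runs from `e ∈ B` up to `x` when every `B`-vertex of `[e, x)` has its successor in `B`; the whole
interval `[e, x]` then lies in `B`. -/
theorem bob_run (P' : Rulers q t) (B : Finset (Fin (3 * q + 1))) (k : Fin t) :
    ∀ d : ℕ, ∀ e x : Fin (3 * q + 1), (P' k x).val = (P' k e).val + d → e ∈ B →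
      (∀ u, (P' k e).val ≤ (P' k u).val → (P' k u).val < (P' k x).val → u ∈ B → succ P' k u ∈ B) →
      Relation.ReflTransGen (Arc P' k (fun a b => a ∈ B ∧ b ∈ B)) e x ∧
      ∀ u, (P' k e).val ≤ (P' k u).val → (P' k u).val ≤ (P' k x).val → u ∈ B := by
  intro d
  induction d with
  | zero =>
    intro e x h he _
    have hxe : x = e := (P' k).injective (Fin.ext (by simpa using h))
    subst hxe
    refine ⟨Relation.ReflTransGen.refl, fun u h1 h2 => ?_⟩
    have : u = x := (P' k).injective (Fin.ext (by omega))
    subst this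
    exact he
  | succ d ih =>
    intro e x h he hrun
    have hne : (P' k e).val ≠ 3 * q := by
      have := (P' k x).isLt
      omega
    have hse : succ P' k e ∈ B := hrun e le_rfl (by omega) he
    have hstep : Arc P' k (fun a b => a ∈ B ∧ b ∈ B) e (succ P' k e) :=
      ⟨k, e, ⟨he, hse⟩, Or.inl ⟨rfl, rfl, rfl, hne⟩⟩
    have hval := val_succ P' k e hne
    obtain ⟨hreach, hmem⟩ := ih (succ P' k e) x (by omega) hse
      (fun u hu1 hu2 hu3 => hrun u (by omega) hu2 hu3)
    refine ⟨Relation.ReflTransGen.head hstep hreach, fun u h1 h2 => ?_⟩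
    by_cases hu : (P' k u).val = (P' k e).val
    · have : u = e := (P' k).injective (Fin.ext hu)
      subst this
      exact he
    · exact hmem u (by omega) h2

/-- above any `e ∈ B` there is a least `B`-vertex whose successor leaves `B` (Bob's wrap not being inside `B`). -/
theorem exists_min_exit (P' : Rulers q t) (B : Finset (Fin (3 * q + 1))) (k : Fin t)
    (lam' : Fin (3 * q + 1)) (hlast' : (P' k lam').val = 3 * q) (hlam'A : lam' ∉ B)
    (e : Fin (3 * q + 1)) (he : e ∈ B) :
    ∃ x, (x ∈ B ∧ succ P' k x ∉ B ∧ (P' k e).val ≤ (P' k x).val) ∧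
      ∀ y, y ∈ B → succ P' k y ∉ B → (P' k e).val ≤ (P' k y).val → (P' k x).val ≤ (P' k y).val := by
  classical
  -- the least vertex above `e` outside `B`; its predecessor is a candidate
  obtain ⟨w, hw, hwmin⟩ := Finset.exists_min_image
    (Finset.univ.filter fun u => u ∉ B ∧ (P' k e).val ≤ (P' k u).val) (fun u => (P' k u).val)
    ⟨lam', by
      simp only [Finset.mem_filter, Finset.mem_univ, true_and]
      exact ⟨hlam'A, by have := (P' k e).isLt; omega⟩⟩
  simp only [Finset.mem_filter, Finset.mem_univ, true_and] at hw hwmin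
  have hwe : (P' k e).val < (P' k w).val := by
    rcases Nat.lt_or_ge (P' k e).val (P' k w).val with h | h
    · exact h
    · have : w = e := (P' k).injective (Fin.ext (by omega))
      exact absurd he (this ▸ hw.1)
  have hw0 : (P' k w).val ≠ 0 := by omega
  have hvp := val_pred P' k w hw0
  have hpB : pred P' k w ∈ B := by
    by_contra hp
    have := hwmin (pred P' k w) ⟨hp, by omega⟩
    omega
  have hcand : (Finset.univ.filter fun y =>
      y ∈ B ∧ succ P' k y ∉ B ∧ (P' k e).val ≤ (P' k y).val).Nonempty :=
    ⟨pred P' k w, by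
      simp only [Finset.mem_filter, Finset.mem_univ, true_and]
      exact ⟨hpB, by rw [succ_pred]; exact hw.1, by omega⟩⟩
  obtain ⟨x, hx, hxmin⟩ := Finset.exists_min_image _ (fun u => (P' k u).val) hcand
  simp only [Finset.mem_filter, Finset.mem_univ, true_and] at hx hxmin
  exact ⟨x, hx, fun y h1 h2 h3 => hxmin y ⟨h1, h2, h3⟩⟩

/-- a least stuck vertex above `x`, if any. -/
theorem exists_min_stuck (P : Rulers q t) (B : Finset (Fin (3 * q + 1))) (k : Fin t) (x : Fin (3 * q + 1))
    (h : ∃ w, (w ∈ B ∧ succ P k w ∈ B) ∧ (P k x).val < (P k w).val) :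
    ∃ w, ((w ∈ B ∧ succ P k w ∈ B) ∧ (P k x).val < (P k w).val) ∧
      ∀ w', (w' ∈ B ∧ succ P k w' ∈ B) → (P k x).val < (P k w').val → (P k w).val ≤ (P k w').val := by
  classical
  obtain ⟨w₀, hw₀⟩ := h
  obtain ⟨w, hw, hwmin⟩ := Finset.exists_min_image
    (Finset.univ.filter fun w => (w ∈ B ∧ succ P k w ∈ B) ∧ (P k x).val < (P k w).val)
    (fun u => (P k u).val) ⟨w₀, by simpa using hw₀⟩
  simp only [Finset.mem_filter, Finset.mem_univ, true_and] at hw hwmin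
  exact ⟨w, hw, fun w' h1 h2 => hwmin w' ⟨h1, h2⟩⟩

/-- SHARED PORTALS, concrete form: `φ ⇝ λ` in frame `k` for every (row, column) pair of the portal rectangle. -/
theorem frame_reach_of_portals (P P' : Rulers q t) (B : Finset (Fin (3 * q + 1))) (k : Fin t)
    (lam lam' : Fin (3 * q + 1)) (hlast : (P k lam).val = 3 * q) (hlast' : (P' k lam').val = 3 * q)
    (hlamA : lam ∉ B) (hphiA : succ P k lam ∉ B) (hlam'A : lam' ∉ B)
    (Ein Eout : Finset (Fin (3 * q + 1)))
    (rowIn : ∀ u, u ∈ B → succ P k u ∈ B → pred P k u ∉ B → u ∈ Ein)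
    (rowOut : ∀ x ∈ Eout, x ∈ B ∧ succ P k x ∉ B ∧ pred P k x ∈ B)
    (colIn : ∀ e ∈ Ein, e ∈ B ∧ succ P' k e ∈ B ∧ pred P' k e ∉ B)
    (colOut : ∀ u, u ∈ B → succ P' k u ∉ B → pred P' k u ∈ B → u ∈ Eout) :
    Relation.ReflTransGen (HybridArc P P' B k) (succ P k lam) lam := by
  classical
  -- lifts
  have liftA : ∀ {a b}, Relation.ReflTransGen (Arc P k (fun a b => a ∉ B ∨ b ∉ B)) a b →
      Relation.ReflTransGen (HybridArc P P' B k) a b := by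
    intro a b h
    induction h with
    | refl => exact Relation.ReflTransGen.refl
    | tail _ hbc ih => exact ih.tail (Or.inl hbc)
  have liftB : ∀ {a b}, Relation.ReflTransGen (Arc P' k (fun a b => a ∈ B ∧ b ∈ B)) a b →
      Relation.ReflTransGen (HybridArc P P' B k) a b := by
    intro a b h
    induction h with
    | refl => exact Relation.ReflTransGen.refl
    | tail _ hbc ih => exact ih.tail (Or.inr hbc)
  have hphi0 := val_phi P k lam hlast
  -- Bob's run map π
  let π : Fin (3 * q + 1) → Fin (3 * q + 1) := fun e =>
    if h : e ∈ B then Classical.choose (exists_min_exit P' B k lam' hlast' hlam'A e h) else e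
  have hπspec : ∀ e, (he : e ∈ B) →
      (π e ∈ B ∧ succ P' k (π e) ∉ B ∧ (P' k e).val ≤ (P' k (π e)).val) ∧
      ∀ y, y ∈ B → succ P' k y ∉ B → (P' k e).val ≤ (P' k y).val → (P' k (π e)).val ≤ (P' k y).val := by
    intro e he
    have := Classical.choose_spec (exists_min_exit P' B k lam' hlast' hlam'A e he)
    simp only [π, dif_pos he]
    exact this
  -- the run [e, π e] : reachability and membership in B
  have hπrun : ∀ e, e ∈ B →
      Relation.ReflTransGen (Arc P' k (fun a b => a ∈ B ∧ b ∈ B)) e (π e) ∧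
      ∀ u, (P' k e).val ≤ (P' k u).val → (P' k u).val ≤ (P' k (π e)).val → u ∈ B := by
    intro e he
    obtain ⟨⟨hxB, hxs, hxe⟩, hxmin⟩ := hπspec e he
    refine bob_run P' B k ((P' k (π e)).val - (P' k e).val) e (π e) (by omega) he ?_
    intro u hu1 hu2 hu3
    by_contra hsu
    have := hxmin u hu3 hsu hu1
    omega
  have hπ : ∀ e ∈ Ein, π e ∈ Eout ∧ Relation.ReflTransGen (HybridArc P P' B k) e (π e) := by
    intro e heE
    obtain ⟨heB, hse, hpe⟩ := colIn e heE
    obtain ⟨⟨hxB, hxs, hxe⟩, hxmin⟩ := hπspec e heB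
    obtain ⟨hreach, hmem⟩ := hπrun e heB
    refine ⟨colOut (π e) hxB hxs ?_, liftB hreach⟩
    -- pred (π e) lies in the run
    have hne : π e ≠ e := fun h => hxs (by rw [h]; exact hse)
    have hlt : (P' k e).val < (P' k (π e)).val := by
      rcases Nat.lt_or_ge (P' k e).val (P' k (π e)).val with h | h
      · exact h
      · exact absurd ((P' k).injective (Fin.ext (by omega))) hne
    have hvp := val_pred P' k (π e) (by omega)
    exact hmem (pred P' k (π e)) (by omega) (by omega)
  have hπinj : Set.InjOn π Ein := by
    -- ordered version
    have key : ∀ e₁ ∈ Ein, ∀ e₂ ∈ Ein, (P' k e₁).val < (P' k e₂).val → π e₁ ≠ π e₂ := by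
      intro e₁ h₁ e₂ h₂ hlt heq
      obtain ⟨h₁B, -, -⟩ := colIn e₁ h₁
      obtain ⟨h₂B, -, hp₂⟩ := colIn e₂ h₂
      obtain ⟨⟨-, -, hxe₂⟩, -⟩ := hπspec e₂ h₂B
      obtain ⟨-, hmem⟩ := hπrun e₁ h₁B
      have hvp := val_pred P' k e₂ (by omega)
      exact hp₂ (hmem (pred P' k e₂) (by omega) (by rw [heq]; omega))
    intro e₁ h₁ e₂ h₂ heq
    rcases lt_trichotomy (P' k e₁).val (P' k e₂).val with h | h | h
    · exact absurd heq (key e₁ h₁ e₂ h₂ h)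
    · exact (P' k).injective (Fin.ext h)
    · exact absurd heq.symm (key e₂ h₂ e₁ h₁ h)
  -- Alice's climb map ν (also used from φ)
  let ν : Fin (3 * q + 1) → Fin (3 * q + 1) := fun x =>
    if h : ∃ w, (w ∈ B ∧ succ P k w ∈ B) ∧ (P k x).val < (P k w).val
    then Classical.choose (exists_min_stuck P B k x h) else lam
  have hνstuck : ∀ x, (h : ∃ w, (w ∈ B ∧ succ P k w ∈ B) ∧ (P k x).val < (P k w).val) →
      ((ν x ∈ B ∧ succ P k (ν x) ∈ B) ∧ (P k x).val < (P k (ν x)).val) ∧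
      ∀ w', (w' ∈ B ∧ succ P k w' ∈ B) → (P k x).val < (P k w').val → (P k (ν x)).val ≤ (P k w').val := by
    intro x h
    have := Classical.choose_spec (exists_min_stuck P B k x h)
    simp only [ν, dif_pos h]
    exact this
  have hνlam : ∀ x, (¬ ∃ w, (w ∈ B ∧ succ P k w ∈ B) ∧ (P k x).val < (P k w).val) → ν x = lam := by
    intro x h
    simp only [ν, dif_neg h]
  -- reachability x ⇝ ν x for a non-stuck start
  have hνreach : ∀ x, (x ∉ B ∨ succ P k x ∉ B) →
      Relation.ReflTransGen (Arc P k (fun a b => a ∉ B ∨ b ∉ B)) x (ν x) := by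
    intro x hx
    by_cases h : ∃ w, (w ∈ B ∧ succ P k w ∈ B) ∧ (P k x).val < (P k w).val
    · obtain ⟨⟨-, hlt⟩, hmin⟩ := hνstuck x h
      refine climb_between P B k ((P k (ν x)).val - (P k x).val) x (ν x) (by omega) ?_
      intro u hu1 hu2
      by_cases hux : (P k u).val = (P k x).val
      · have : u = x := (P k).injective (Fin.ext hux)
        rw [this]; exact hx
      · by_cases huB : u ∈ B
        · right
          intro hsu
          have := hmin u ⟨huB, hsu⟩ (by omega)
          omega
        · exact Or.inl huB
    · rw [hνlam x h]
      refine climb_between P B k ((P k lam).val - (P k x).val) x lam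
        (by have := (P k x).isLt; omega) ?_
      intro u hu1 hu2
      by_cases hux : (P k u).val = (P k x).val
      · have : u = x := (P k).injective (Fin.ext hux)
        rw [this]; exact hx
      · by_cases huB : u ∈ B
        · right
          intro hsu
          exact h ⟨u, ⟨huB, hsu⟩, by omega⟩
        · exact Or.inl huB
  -- ν x is a proper entry (hence in Ein) or λ, for x a proper exit or x = φ
  have hνrange : ∀ x, (x ∉ B ∨ succ P k x ∉ B) → (ν x ∈ Ein ∨ ν x = lam) := by
    intro x hx
    by_cases h : ∃ w, (w ∈ B ∧ succ P k w ∈ B) ∧ (P k x).val < (P k w).val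
    · left
      obtain ⟨⟨⟨hwB, hsw⟩, hlt⟩, hmin⟩ := hνstuck x h
      refine rowIn (ν x) hwB hsw ?_
      intro hpB
      have hvp := val_pred P k (ν x) (by omega)
      by_cases hpx : (P k (pred P k (ν x))).val = (P k x).val
      · have hp : pred P k (ν x) = x := (P k).injective (Fin.ext hpx)
        have hsx : succ P k x = ν x := by
          have := succ_pred P k (ν x)
          rw [hp] at this
          exact this
        rcases hx with hx | hx
        · exact hx (hp ▸ hpB)
        · exact hx (hsx ▸ hwB)
      · have := hmin (pred P k (ν x)) ⟨hpB, by rw [succ_pred]; exact hwB⟩ (by omega)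
        omega
    · right; exact hνlam x h
  have hν : ∀ x ∈ Eout, (ν x ∈ Ein ∨ ν x = lam) ∧ Relation.ReflTransGen (HybridArc P P' B k) x (ν x) := by
    intro x hxE
    obtain ⟨-, hsx, -⟩ := rowOut x hxE
    exact ⟨hνrange x (Or.inr hsx), liftA (hνreach x (Or.inr hsx))⟩
  -- a proper exit strictly below a stuck vertex: pred x₂ is stuck and above x₁
  have hνinj : Set.InjOn ν Eout := by
    have key : ∀ x₁ ∈ Eout, ∀ x₂ ∈ Eout, (P k x₁).val < (P k x₂).val → ν x₁ ≠ ν x₂ := by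
      intro x₁ h₁ x₂ h₂ hlt heq
      obtain ⟨h₁B, hs₁, -⟩ := rowOut x₁ h₁
      obtain ⟨h₂B, -, hp₂⟩ := rowOut x₂ h₂
      have hvp := val_pred P k x₂ (by omega)
      -- pred x₂ is stuck, strictly above x₁
      have hne : pred P k x₂ ≠ x₁ := by
        intro h
        apply hs₁
        rw [← h, succ_pred]; exact h₂B
      have hgt : (P k x₁).val < (P k (pred P k x₂)).val := by
        rcases Nat.lt_or_ge (P k x₁).val (P k (pred P k x₂)).val with h | h
        · exact h
        · exact absurd ((P k).injective (Fin.ext (by omega))) hne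
      have hex₁ : ∃ w, (w ∈ B ∧ succ P k w ∈ B) ∧ (P k x₁).val < (P k w).val :=
        ⟨pred P k x₂, ⟨hp₂, by rw [succ_pred]; exact h₂B⟩, hgt⟩
      obtain ⟨⟨⟨hw₁B, -⟩, -⟩, hmin₁⟩ := hνstuck x₁ hex₁
      have hle := hmin₁ (pred P k x₂) ⟨hp₂, by rw [succ_pred]; exact h₂B⟩ hgt
      by_cases hex₂ : ∃ w, (w ∈ B ∧ succ P k w ∈ B) ∧ (P k x₂).val < (P k w).val
      · obtain ⟨⟨-, hlt₂⟩, -⟩ := hνstuck x₂ hex₂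
        rw [heq] at hle
        omega
      · rw [hνlam x₂ hex₂] at heq
        exact hlamA (heq ▸ hw₁B)
    intro x₁ h₁ x₂ h₂ heq
    rcases lt_trichotomy (P k x₁).val (P k x₂).val with h | h | h
    · exact absurd heq (key x₁ h₁ x₂ h₂ h)
    · exact (P k).injective (Fin.ext h)
    · exact absurd heq.symm (key x₂ h₂ x₁ h₁ h)
  -- the first entry e₁ = ν φ
  have he₁ : Relation.ReflTransGen (HybridArc P P' B k) (succ P k lam) (ν (succ P k lam)) :=
    liftA (hνreach _ (Or.inl hphiA))
  have he₁' : ν (succ P k lam) = lam ∨ (ν (succ P k lam) ∈ Ein ∧ ∀ x ∈ Eout, ν x ≠ ν (succ P k lam)) := by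
    by_cases h : ∃ w, (w ∈ B ∧ succ P k w ∈ B) ∧ (P k (succ P k lam)).val < (P k w).val
    · right
      rcases hνrange _ (Or.inl hphiA) with hin | hl
      · refine ⟨hin, fun x hxE heq => ?_⟩
        obtain ⟨hxB, -, hpx⟩ := rowOut x hxE
        obtain ⟨⟨⟨hwB, -⟩, -⟩, hmin⟩ := hνstuck _ h
        -- pred x is stuck and above φ
        have hx0 : (P k x).val ≠ 0 := by
          intro h0
          have : x = succ P k lam := (P k).injective (Fin.ext (by omega))
          exact hphiA (this ▸ hxB)
        have hvp := val_pred P k x hx0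
        have hp0 : (P k (pred P k x)).val ≠ 0 := by
          intro h0
          have : pred P k x = succ P k lam := (P k).injective (Fin.ext (by omega))
          exact hphiA (this ▸ hpx)
        have hle := hmin (pred P k x) ⟨hpx, by rw [succ_pred]; exact hxB⟩ (by omega)
        by_cases hex : ∃ w, (w ∈ B ∧ succ P k w ∈ B) ∧ (P k x).val < (P k w).val
        · obtain ⟨⟨-, hlt⟩, -⟩ := hνstuck x hex
          rw [heq] at hlt
          omega
        · rw [hνlam x hex] at heq
          exact hlamA (heq.symm ▸ hwB)
      · obtain ⟨⟨⟨hwB, -⟩, -⟩, -⟩ := hνstuck _ h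
        exact absurd (hl ▸ hwB) hlamA
    · left; exact hνlam _ h
  exact reach_of_portals (HybridArc P P' B k) (succ P k lam) lam (ν (succ P k lam)) Ein Eout π ν
    hπ hπinj hν hνinj he₁ he₁'

/-- SHARED-PORTAL BLOCKING CERTIFICATE FOR ONE FRAME: the portal hypotheses of `frame_reach_of_portals`
plus ROW-ONLY DESCENT `hdesc` — `φ` is reachable from `λ` using Alice's arcs alone (a condition on her system and `B`
only; in the random-ruler model it holds in ≥ 99 % of frames, memo note g26-4) — leave no jointly closed phase.
(A two-arc shortcut `λ → w → φ` through a common foreign neighbour would do, but is impossible for NORMAL systems: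
normality forces residue `1` on foreign neighbours of `λ` and residue `2` on those of `φ`.) -/
theorem frame_blocked_of_portals (P P' : Rulers q t) (B : Finset (Fin (3 * q + 1))) (k : Fin t)
    (lam lam' : Fin (3 * q + 1)) (hlast : (P k lam).val = 3 * q) (hlast' : (P' k lam').val = 3 * q)
    (hlamA : lam ∉ B) (hphiA : succ P k lam ∉ B) (hlam'A : lam' ∉ B)
    (Ein Eout : Finset (Fin (3 * q + 1)))
    (rowIn : ∀ u, u ∈ B → succ P k u ∈ B → pred P k u ∉ B → u ∈ Ein)
    (rowOut : ∀ x ∈ Eout, x ∈ B ∧ succ P k x ∉ B ∧ pred P k x ∈ B)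
    (colIn : ∀ e ∈ Ein, e ∈ B ∧ succ P' k e ∈ B ∧ pred P' k e ∉ B)
    (colOut : ∀ u, u ∈ B → succ P' k u ∉ B → pred P' k u ∈ B → u ∈ Eout)
    (hdesc : Relation.ReflTransGen (Arc P k (fun a b => a ∉ B ∨ b ∉ B)) lam (succ P k lam))
    (x : Fin (3 * q + 1) → Bool) :
    ¬ (FrameClosed P k (fun u w => u ∉ B ∨ w ∉ B) x ∧ FrameClosed P' k (fun u w => u ∈ B ∧ w ∈ B) x) := by
  have lift : ∀ v, Relation.ReflTransGen (Arc P k (fun a b => a ∉ B ∨ b ∉ B)) lam v →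
      Relation.ReflTransGen (HybridArc P P' B k) lam v := by
    intro v hv
    induction hv with
    | refl => exact Relation.ReflTransGen.refl
    | tail _ hbc ih => exact ih.tail (Or.inl hbc)
  have h₂ : Relation.ReflTransGen (HybridArc P P' B k) lam (succ P k lam) := lift _ hdesc
  exact frame_blocked_of_reach P P' B k lam hlast (Or.inl hlamA)
    (frame_reach_of_portals P P' B k lam lam' hlast hlast' hlamA hphiA hlam'A Ein Eout rowIn rowOut colIn colOut)
    h₂ x

/-- SHARED-PORTAL CERTIFICATE, all frames: per-frame portal data as in `frame_blocked_of_portals` gives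
`TwoBlocked P P' B`. -/
theorem twoBlocked_of_portals (P P' : Rulers q t) (B : Finset (Fin (3 * q + 1)))
    (lam lam' : Fin t → Fin (3 * q + 1))
    (hlast : ∀ k, (P k (lam k)).val = 3 * q) (hlast' : ∀ k, (P' k (lam' k)).val = 3 * q)
    (hlamA : ∀ k, lam k ∉ B) (hphiA : ∀ k, succ P k (lam k) ∉ B) (hlam'A : ∀ k, lam' k ∉ B)
    (Ein Eout : Fin t → Finset (Fin (3 * q + 1)))
    (rowIn : ∀ k u, u ∈ B → succ P k u ∈ B → pred P k u ∉ B → u ∈ Ein k)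
    (rowOut : ∀ k, ∀ x ∈ Eout k, x ∈ B ∧ succ P k x ∉ B ∧ pred P k x ∈ B)
    (colIn : ∀ k, ∀ e ∈ Ein k, e ∈ B ∧ succ P' k e ∈ B ∧ pred P' k e ∉ B)
    (colOut : ∀ k u, u ∈ B → succ P' k u ∉ B → pred P' k u ∈ B → u ∈ Eout k)
    (hdesc : ∀ k, Relation.ReflTransGen (Arc P k (fun a b => a ∉ B ∨ b ∉ B)) (lam k) (succ P k (lam k))) :
    TwoBlocked P P' B := fun k x =>
  frame_blocked_of_portals P P' B k (lam k) (lam' k) (hlast k) (hlast' k) (hlamA k) (hphiA k) (hlam'A k)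
    (Ein k) (Eout k) (rowIn k) (rowOut k) (colIn k) (colOut k) (hdesc k) x

end Summit.PneNP.PneNP.Cruxes.FoolingMeasure.IdeasR2s1g26
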